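import Mathlib
import Summits.Ventures.PercRepro.TriangleCapSubBandInterval

/-!
# PercRepro — THE DEEP PART OF THE BAND IS ONE INTERVAL: THE SUB-BANDS OVERLAP FROM `u ≥ (t − 3)/3` ON (p3, gen 52;
part 265)

The width of the sub-band `u` is at least `u` (`two_mul_width_ge`: `u (u + 1) − coll u (lfRR (ℓ − 1) 0) ≥ 2 u`), so
consecutive sub-band intervals `[B(u), B(u) + W(u, ℓ)]`, `B(u) = u (t − u − 1)`, overlap as soon as
`t ≤ 3 u + 3` (`B(u + 1) ≤ B(u) + u + 1`, `subband_overlap`).  Hence (`band_deep_interval`) for `2 ≤ ℓ ≤ u₁ + 1`,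
`t ≤ 3 u₁ + 3`, `u₁ ≤ u₂`, `2 u₂ ≤ t`, `2 t ≤ s`, EVERY `j` from `B(u₁)` to the top of the sub-band `u₂` is
attained on `ℓ + 1 + (s − t)` vertices — the band is one interval there.  For `ℓ = 2` the sub-band `u` is
`[u (t − u − 1), u (t − u)]` and, for even `t`, `u₂ = t / 2` has the top `t² / 4`, the extremal value of part 247:
the band on `3 + (s − t)` vertices consists of the separate intervals `{0, 1}`, `[t − 2, t − 1]`, `[2 t − 6, 2 t − 4]`,
`[3 t − 12, 3 t − 9]`, … (part 264, down to the depth `u₀` with `4 u₀ + 3 ≤ t`) and of one interval from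
`B(u₁)`, `3 u₁ + 3 ≥ t`, to `t² / 4`.  Axioms: standard.
-/

namespace PercRepro

namespace TriangleCap

namespace C047

open Finset

/-- The sub-band width is at least `u`: `2 u ≤ u (u + 1) − coll u (lfRR k 0)`. -/
theorem two_mul_width_ge (u k : ℕ) : 2 * u ≤ u * (u + 1) - coll u (lfRR k 0) := by
  have h := coll_le u (lfRR k 0)
  have e : u * (u + 1) = u * (u - 1) + 2 * u := by
    rcases u with _ | u'
    · simp
    · rw [Nat.add_sub_cancel]
      ring
  omega

/-- **THE OVERLAP:** for `t ≤ 3 u + 3`, `B(u + 1) ≤ B(u) + u + 1`. -/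
theorem subband_overlap (t u : ℕ) (h : t ≤ 3 * u + 3) :
    (u + 1) * (t - (u + 1) - 1) ≤ u * (t - u - 1) + u + 1 := by
  rcases Nat.lt_or_ge t (u + 2) with h1 | h1
  · have : t - (u + 1) - 1 = 0 := by omega
    rw [this]
    omega
  · obtain ⟨d, rfl⟩ : ∃ d, t = u + 2 + d := ⟨t - u - 2, by omega⟩
    have e1 : u + 2 + d - (u + 1) - 1 = d := by omega
    have e2 : u + 2 + d - u - 1 = d + 1 := by omega
    rw [e1, e2]
    nlinarith

/-- **THE DEEP PART OF THE BAND IS ONE INTERVAL:** for `2 ≤ ℓ ≤ u₁ + 1`, `t ≤ 3 u₁ + 3`, `u₁ ≤ u₂`, `2 u₂ ≤ t`, `2 t ≤ s`,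
every `j` with `u₁ (t − u₁ − 1) ≤ j` and `2 j ≤ 2 u₂ (t − u₂ − 1) + (u₂ (u₂ + 1) − coll u₂ (lfRR (ℓ − 1) 0))` (the
top of the sub-band `u₂`) is attained on `ℓ + 1 + (s − t)` vertices. -/
theorem band_deep_interval (ℓ s t u₁ u₂ : ℕ) (hℓ : 2 ≤ ℓ) (hℓu : ℓ ≤ u₁ + 1) (ht : t ≤ 3 * u₁ + 3) (hu : u₁ ≤ u₂)
    (hut : 2 * u₂ ≤ t) (hs : 2 * t ≤ s) :
    ∀ j, u₁ * (t - u₁ - 1) ≤ j →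
      2 * j ≤ 2 * (u₂ * (t - u₂ - 1)) + (u₂ * (u₂ + 1) - coll u₂ (lfRR (ℓ - 1) 0)) →
      ∃ (H : SimpleGraph (Fin (ℓ + 1 + (s - t)))) (_ : DecidableRel H.Adj), H.CliqueFree 3 ∧
        H.edgeFinset.card = s ∧ (∃ w, deg H w + t = s) ∧
        ∑ v, deg H v * deg H v + 2 * (t * (s - t - 1)) + 2 * j = s * (s + 1) := by
  -- descending induction on `u` from `u₂` to `u₁`
  suffices key : ∀ d, ∀ u, u + d = u₂ → u₁ ≤ u → ∀ j, u * (t - u - 1) ≤ j →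
      2 * j ≤ 2 * (u₂ * (t - u₂ - 1)) + (u₂ * (u₂ + 1) - coll u₂ (lfRR (ℓ - 1) 0)) →
      ∃ (H : SimpleGraph (Fin (ℓ + 1 + (s - t)))) (_ : DecidableRel H.Adj), H.CliqueFree 3 ∧
        H.edgeFinset.card = s ∧ (∃ w, deg H w + t = s) ∧
        ∑ v, deg H v * deg H v + 2 * (t * (s - t - 1)) + 2 * j = s * (s + 1) by
    intro j hj1 hj2
    exact key (u₂ - u₁) u₁ (by omega) le_rfl j hj1 hj2
  intro d
  induction d with
  | zero =>
    intro u hu' _ j hj1 hj2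
    rw [Nat.add_zero] at hu'
    subst hu'
    apply subband_interval ℓ s t u (ℓ - 1) j (by omega) (by omega) (by omega) hut (by omega) hs hj1
    have e : ℓ - 1 - (ℓ - 1) = 0 := Nat.sub_self _
    rw [e]
    omega
  | succ d ih =>
    intro u hu' hu1 j hj1 hj2
    have hu2 : u + 1 ≤ u₂ := by omega
    -- inside the sub-band `u`, or above its top and hence in the sub-band `u + 1` or beyond
    by_cases hin : 2 * j ≤ 2 * (u * (t - u - 1)) + (u * (u + 1) - coll u (lfRR (ℓ - 1) 0))
    · apply subband_interval ℓ s t u (ℓ - 1) j (by omega) (by omega) (by omega) (by omega) (by omega) hs hj1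
      have e : ℓ - 1 - (ℓ - 1) = 0 := Nat.sub_self _
      rw [e]
      omega
    · have hw := two_mul_width_ge u (ℓ - 1)
      have hov := subband_overlap t u (by omega)
      exact ih (u + 1) (by omega) (by omega) j (by omega) hj2

end C047

end TriangleCap

end PercRepro
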